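import Literature.MathematicalPhysics.QuantumFieldTheory.Federbush1986.PhaseCellIVThmA2Embedded

/-!
# Federbush, *A phase cell approach to Yang–Mills theory. IV. The choice of variables* (CMP **114** (1988) 317–343) —
# §11 «Gauge interpolation», p. 337: GEOMETRIC CONSTRUCTIONS 1 and 2, (11.4)–(11.6), as TYPED STATEMENTS (every edge length
# `L_r`), Construction 1 PROVED for the model targets `S^{t−1}`, `t ≥ 2` (U(1), SU(2)), Construction 2 DERIVED from Theorem A.2
# (embedded reading) by rescaling — hence PROVED for every uniformly Lipschitz-retractable target and for all spheres

statement-level skeleton of published theorems with citation tags; proofs where landed; nothing here is a claim about the Yang–Mills mass gap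

Cell `lit-balaban`, reader/typer block **r19** (F4 fold owner), SKELETON rows `F4.Eq11.4` (and the inventory row `F4.Def§11`)
of `run/shared/lean/pub/lit-balaban/lit-balaban-r19/ROWS-F4.md`.

**Source.** P. Federbush, Commun. Math. Phys. **114** (1988) 317–343 [bib `Federbush1988PhaseCellIV`; doi:10.1007/bf01225039;
lit store `paper:doi-10-1007-bf01225039`; journal page = PDF page + 316], p. 337 [PDF 21] read as an image (render
`lit-balaban-r19/renders/f4/f4-p021.png`).  Verbatim: «Let `e` be an edge in `ℰʳ`. … We let `e = v_a v_b`, and consider `φ′₁(v_a)`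
and `φ′₁(v_b)`.  *Geometric Construction 1.* We find an extension of `φ′₁(x)`, `ᵉφ′₁(x)`, to a mapping from `e → G` (a gauge on
`e`) such that a) `ᵉφ′₁(v_a)` and `ᵉφ′₁(v_b)` assume given values. b) `Λ₁(ᵉφ′₁) ≤ c · d(φ′₁(v_b), φ′₁(v_a))/L_r` (11.4), where
`Λ₁(φ) = Sup_{x,y} d(φ(x), φ(y))/|x − y|`.  We note that if `φ′₁(v_a)` and `φ′₁(v_b)` are close enough, then they may be joined by
a geodesic, and `c` picked equal 1.  We now extend the gauges to `e` of the other hypercubes containing `e`. Let `H₂` be one of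
these.  *Geometric Construction 2.* We extend `φ₂(x)` from a mapping on `v_a` and `v_b` to a mapping from `e → G`, such that
a) `d^g(ᵉφ₁, ᵉφ₂) ≤ c d^g(φ₁, φ₂)` (11.5), b) `Λ₁(ᵉφ₂) ≤ c(Λ₁(ᵉφ₁) + d^g(φ₁, φ₂)/L_r + Λ₁(φ₂))` (11.6), where `ᵉφ` and `Λ₁` are as
above.»  (`L_r` = the length of a level-`r` edge; Appendix A part B, p. 341, is titled «Geometric Constructions 2 and 4» and
proves them as Theorem A.2, under its hypothesis `d^M(f₁, f₂) ≤ ε_M`.)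

**What this file does.**  The target `G` is read, as in `PhaseCellIVThmA2Embedded` / `ThmA3` / `ThmA4`, as a SET
`M ⊆ EuclideanSpace ℝ (Fin t)` with the ambient distance.
* `GeomConstruction1 t M` = (11.4) for every edge length `ℓ = L_r > 0` (the edge is the segment `[0, ℓ] ⊂ ℝ`, `v_a = 0`, `v_b = ℓ`),
  one constant `c` for all edges and all pairs of end values.  PROVED for the sphere `S^{t−1} ⊂ ℝᵗ`, `t ≥ 2`
  (`geomConstruction1_sphere`, `c = 6`): the path is two retracted chords `s ↦ (p + s(m − p))/|p + s(m − p)|` through a «midpoint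
  direction» `m` (`m = (p+q)/|p+q|`, or a unit vector orthogonal to `p` when `q = −p`); along each chord `|p + s(m − p)| ≥ 7/10`
  because `⟪p, m⟫ ≥ 0`, so the radial projection costs a factor `20/7`.  In particular `U(1) = S¹`, `SU(2) ≅ S³`.  Print's remark «if
  … close enough, then they may be joined by a geodesic, and `c` picked equal 1» has the companion `exists_shortPath_of_retract`:
  in a uniformly Lipschitz-retractable `M`, two points at distance `< r` are joined by a retracted chord with `c = L`.
* `GeomConstruction2 t M` = (11.5)–(11.6) for every edge length `ℓ` (the edge as the closed ball of radius `ℓ/2` in `ℝ¹`, its end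
  points `v_a, v_b` = the sphere of radius `ℓ/2`), with Theorem A.2's smallness hypothesis `d^g(φ₁, φ₂) ≤ ε` and one `c` for (11.5)
  and (11.6).  `thmA2Emb_rescale` moves Theorem A.2 (embedded reading) from the unit ball to balls of radius `R` (same constants;
  the middle term becomes `d^M(f₁, f₂)/R` — the `1/L_r` of (11.6)); `geomConstruction2_of_thmA2Emb` then gives (11.5)–(11.6) from
  `ThmA2Emb 1 t M`, hence `geomConstruction2_of_retract` (every uniformly Lipschitz-retractable `M`) and `geomConstruction2_sphere`
  (all `S^{t−1}`, hypothesis-free).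
-/

namespace Literature.MathematicalPhysics.QuantumFieldTheory.Federbush1986

noncomputable section

open scoped NNReal ENNReal RealInnerProductSpace
open Set Metric

namespace PhaseCellIVAppA

/-! ## 1. The statements (11.4) and (11.5)–(11.6), every edge length -/

/-- **Geometric Construction 1**, (11.4) p. 337: «We find an extension of `φ′₁(x)`, `ᵉφ′₁(x)`, to a mapping from `e → G` (a gauge
on `e`) such that a) `ᵉφ′₁(v_a)` and `ᵉφ′₁(v_b)` assume given values, b) `Λ₁(ᵉφ′₁) ≤ c · d(φ′₁(v_b), φ′₁(v_a))/L_r`», with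
`Λ₁(φ) = Sup_{x,y} d(φ(x), φ(y))/|x − y|` (`lipConst`).  TYPING: the target `G` is a set `M ⊆ Rᵗ` with the ambient distance
(embedded reading, as `ThmA2Emb`); the edge `e` of length `L_r = ℓ` is `[0, ℓ] ⊂ ℝ` with `v_a = 0`, `v_b = ℓ`; ONE constant `c`
serves every edge length and every pair of end values (print's `c` depends on `G` only); (11.4) in `ℝ≥0∞`.  A `Prop`-valued
definition (proved below for spheres). [cite: Federbush1988PhaseCellIV, (11.4) p. 337] -/
def GeomConstruction1 (t : ℕ) (M : Set (EuclideanSpace ℝ (Fin t))) : Prop :=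
  ∃ c : ℝ≥0, ∀ ℓ : ℝ, ∀ hℓ : 0 < ℓ, ∀ ga gb : ↥M,
    ∃ φ : ↥(Icc (0 : ℝ) ℓ) → ↥M,
      φ ⟨0, left_mem_Icc.mpr hℓ.le⟩ = ga ∧ φ ⟨ℓ, right_mem_Icc.mpr hℓ.le⟩ = gb ∧
        lipConst φ ≤ c * edist ga gb / ENNReal.ofReal ℓ

/-- **Geometric Construction 2**, (11.5)–(11.6) p. 337: «We extend `φ₂(x)` from a mapping on `v_a` and `v_b` to a mapping from
`e → G`, such that a) `d^g(ᵉφ₁, ᵉφ₂) ≤ c d^g(φ₁, φ₂)` (11.5), b) `Λ₁(ᵉφ₂) ≤ c(Λ₁(ᵉφ₁) + d^g(φ₁, φ₂)/L_r + Λ₁(φ₂))` (11.6)»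
(given the extension `ᵉφ₁` of Construction 1; `d^g` = the sup-distance `supDist`).  TYPING: target `M ⊆ Rᵗ` (embedded
reading); the edge of length `L_r = ℓ` is the closed ball of radius `ℓ/2` in `ℝ¹ = EuclideanSpace ℝ (Fin 1)`, its end points
`{v_a, v_b}` the sphere of radius `ℓ/2` (so that Theorem A.2, which Appendix A part B «Geometric Constructions 2 and 4» proves for
this purpose, applies with `n = 1`); the smallness hypothesis `d^g(φ₁, φ₂) ≤ ε` is Theorem A.2's «`d^M(f₁, f₂) ≤ ε_M`»; one
absolute `c` for (11.5) and (11.6), chosen with `ε` before the edge and the maps.  `Prop`-valued definition (proved below from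
`ThmA2Emb 1 t M`). [cite: Federbush1988PhaseCellIV, (11.5)–(11.6) p. 337; Theorem A.2 p. 341] -/
def GeomConstruction2 (t : ℕ) (M : Set (EuclideanSpace ℝ (Fin t))) : Prop :=
  ∃ ε : ℝ≥0, 0 < ε ∧ ∃ c : ℝ≥0, ∀ ℓ : ℝ, 0 < ℓ →
    ∀ (φ₁ φ₂ : ↥(sphere (0 : EuclideanSpace ℝ (Fin 1)) (ℓ / 2)) → ↥M)
      (eφ₁ : ↥(closedBall (0 : EuclideanSpace ℝ (Fin 1)) (ℓ / 2)) → ↥M),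
      (∀ x : ↥(sphere (0 : EuclideanSpace ℝ (Fin 1)) (ℓ / 2)), eφ₁ ⟨x.1, sphere_subset_closedBall x.2⟩ = φ₁ x) →
      supDist φ₁ φ₂ ≤ ε →
      ∃ eφ₂ : ↥(closedBall (0 : EuclideanSpace ℝ (Fin 1)) (ℓ / 2)) → ↥M,
        (∀ x : ↥(sphere (0 : EuclideanSpace ℝ (Fin 1)) (ℓ / 2)), eφ₂ ⟨x.1, sphere_subset_closedBall x.2⟩ = φ₂ x) ∧
        supDist eφ₁ eφ₂ ≤ c * supDist φ₁ φ₂ ∧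
        lipConst eφ₂ ≤ c * (lipConst eφ₁ + supDist φ₁ φ₂ / ENNReal.ofReal ℓ + lipConst φ₂)

namespace GeomConstr

open ThmA2

/-! ## 2. Tools: `Λ₁` of a composition, gluing on intervals, chords on the sphere -/

/-- `Λ₁` of a map is attained pairwise: `d(g(a), g(b)) ≤ Λ₁(g)·|a − b|` (source a metric space).
[cite: Federbush1988PhaseCellIV, (11.4) p. 337] -/
theorem edist_le_lipConst_mul {Y Z : Type*} [MetricSpace Y] [PseudoEMetricSpace Z] (g : Y → Z) (a b : Y) :
    edist (g a) (g b) ≤ lipConst g * edist a b := by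
  by_cases hab : a = b
  · rw [hab, edist_self]
    exact zero_le
  · have h0 : edist a b ≠ 0 := (edist_pos.mpr hab).ne'
    have h1 : edist (g a) (g b) / edist a b ≤ lipConst g :=
      le_iSup₂ (f := fun x y => edist (g x) (g y) / edist x y) a b
    rwa [ENNReal.div_le_iff_le_mul (Or.inl h0) (Or.inl (edist_ne_top a b))] at h1

/-- `Λ₁(g ∘ h) ≤ K · Λ₁(g)` for a `K`-Lipschitz reparametrisation `h` (used for the dilations `x ↦ Rx`, `x ↦ x/R` between the unit
ball/edge and a ball/edge of size `L_r`). [cite: Federbush1988PhaseCellIV, (11.4)–(11.6) p. 337] -/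
theorem lipConst_comp_le {X Y Z : Type*} [PseudoEMetricSpace X] [MetricSpace Y] [PseudoEMetricSpace Z]
    (g : Y → Z) {h : X → Y} {K : ℝ≥0} (hh : LipschitzWith K h) : lipConst (g ∘ h) ≤ K * lipConst g := by
  refine iSup₂_le fun x y => ?_
  refine ENNReal.div_le_of_le_mul ?_
  calc edist ((g ∘ h) x) ((g ∘ h) y)
      ≤ lipConst g * edist (h x) (h y) := edist_le_lipConst_mul g (h x) (h y)
    _ ≤ lipConst g * (K * edist x y) := by gcongr; exact hh x y
    _ = K * lipConst g * edist x y := by ring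

/-- `d^g` can only decrease under a reparametrisation of the common source. [cite: Federbush1988PhaseCellIV, (11.5) p. 337] -/
theorem supDist_comp_le {X Y Z : Type*} [PseudoEMetricSpace Z] (g₁ g₂ : Y → Z) (h : X → Y) :
    supDist (g₁ ∘ h) (g₂ ∘ h) ≤ supDist g₁ g₂ :=
  iSup_le fun x => edist_le_supDist g₁ g₂ (h x)

/-- Gluing two Lipschitz bounds on adjacent intervals (the two chords of the path of Construction 1 meet at the midpoint).
[cite: Federbush1988PhaseCellIV, (11.4) p. 337] -/
theorem lipschitzOnWith_Icc_of_glue {W : Type*} [PseudoMetricSpace W] {g : ℝ → W} {K : ℝ≥0} {a b c : ℝ}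
    (h₁ : LipschitzOnWith K g (Icc a b)) (h₂ : LipschitzOnWith K g (Icc b c)) : LipschitzOnWith K g (Icc a c) := by
  have key : ∀ x y : ℝ, a ≤ x → x ≤ b → b ≤ y → y ≤ c → dist (g x) (g y) ≤ K * dist x y := by
    intro x y hax hxb hby hyc
    have hb₁ : b ∈ Icc a b := ⟨hax.trans hxb, le_rfl⟩
    have hb₂ : b ∈ Icc b c := ⟨le_rfl, hby.trans hyc⟩
    calc dist (g x) (g y) ≤ dist (g x) (g b) + dist (g b) (g y) := dist_triangle _ _ _
      _ ≤ K * dist x b + K * dist b y := add_le_add (h₁.dist_le_mul x ⟨hax, hxb⟩ b hb₁) (h₂.dist_le_mul b hb₂ y ⟨hby, hyc⟩)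
      _ = K * dist x y := by
          rw [Real.dist_eq, Real.dist_eq, Real.dist_eq, abs_of_nonpos (by linarith), abs_of_nonpos (by linarith),
            abs_of_nonpos (by linarith)]
          ring
  refine LipschitzOnWith.of_dist_le_mul fun x hx y hy => ?_
  rcases le_or_gt x b with hxb | hxb <;> rcases le_or_gt y b with hyb | hyb
  · exact h₁.dist_le_mul x ⟨hx.1, hxb⟩ y ⟨hy.1, hyb⟩
  · exact key x y hx.1 hxb hyb.le hy.2
  · rw [dist_comm (g x), dist_comm x]
    exact key y x hy.1 hyb hxb.le hx.2
  · exact h₂.dist_le_mul x ⟨hxb.le, hx.2⟩ y ⟨hyb.le, hy.2⟩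

section Sphere

variable {V : Type*} [NormedAddCommGroup V] [InnerProductSpace ℝ V]

/-- Along the chord from a unit vector `p` towards a unit vector `m` with `⟪p, m⟫ ≥ 0` one stays at distance `≥ 7/10` from the
origin: `|(1 − s)p + s m|² = (1 − s)² + s² + 2s(1 − s)⟪p, m⟫ ≥ ½`. [cite: Federbush1988PhaseCellIV, (11.4) p. 337] -/
theorem norm_chord_ge {p m : V} (hp : ‖p‖ = 1) (hm : ‖m‖ = 1) (hpm : 0 ≤ ⟪p, m⟫) {s : ℝ} (hs0 : 0 ≤ s) (hs1 : s ≤ 1) :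
    7 / 10 ≤ ‖p + s • (m - p)‖ := by
  have heq : p + s • (m - p) = (1 - s) • p + s • m := by
    simp only [smul_sub, sub_smul, one_smul]
    abel
  have hsq : ‖p + s • (m - p)‖ ^ 2 = (1 - s) ^ 2 + s ^ 2 + 2 * ((1 - s) * s * ⟪p, m⟫) := by
    rw [heq, norm_add_sq_real, norm_smul, norm_smul, real_inner_smul_left, real_inner_smul_right, hp, hm,
      Real.norm_eq_abs, Real.norm_eq_abs, mul_one, mul_one, sq_abs, sq_abs]
    ring
  have h1 : 0 ≤ (1 - s) * s * ⟪p, m⟫ := mul_nonneg (mul_nonneg (by linarith) hs0) hpm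
  have h2 : (49 : ℝ) / 100 ≤ ‖p + s • (m - p)‖ ^ 2 := by
    rw [hsq]
    nlinarith [sq_nonneg (s - 1 / 2)]
  nlinarith [norm_nonneg (p + s • (m - p))]

/-- The retracted chord `s ↦ (p + s(m − p))/|p + s(m − p)|` from `p` to `m` (unit vectors with `⟪p, m⟫ ≥ 0`) is
`(20/7)|m − p|`-Lipschitz on `[0, 1]` (radial projection is `20/7`-Lipschitz outside the ball of radius `7/10`).
[cite: Federbush1988PhaseCellIV, (11.4) p. 337] -/
theorem lipschitzOnWith_chord {p m : V} (hp : ‖p‖ = 1) (hm : ‖m‖ = 1) (hpm : 0 ≤ ⟪p, m⟫) :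
    LipschitzOnWith ((20 / 7 : ℝ≥0) * ‖m - p‖₊) (fun s : ℝ => radial (p + s • (m - p))) (Icc (0 : ℝ) 1) := by
  refine LipschitzOnWith.of_dist_le_mul fun s hs s' hs' => ?_
  rw [dist_eq_norm, Real.dist_eq]
  have h := norm_radial_sub_radial_le (x := p + s • (m - p)) (y := p + s' • (m - p)) (ρ := 7 / 10) (by norm_num)
    (norm_chord_ge hp hm hpm hs.1 hs.2) (norm_chord_ge hp hm hpm hs'.1 hs'.2)
  calc ‖radial (p + s • (m - p)) - radial (p + s' • (m - p))‖
      ≤ 2 / (7 / 10) * ‖p + s • (m - p) - (p + s' • (m - p))‖ := h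
    _ = 2 / (7 / 10) * (|s - s'| * ‖m - p‖) := by
        rw [show p + s • (m - p) - (p + s' • (m - p)) = (s - s') • (m - p) by rw [sub_smul]; abel, norm_smul,
          Real.norm_eq_abs]
    _ = ((20 / 7 : ℝ≥0) * ‖m - p‖₊ : ℝ≥0) * |s - s'| := by push_cast; ring

/-- The chord stays on the sphere after projection: `p + s(m − p) ≠ 0`. [cite: Federbush1988PhaseCellIV, (11.4) p. 337] -/
theorem chord_ne_zero {p m : V} (hp : ‖p‖ = 1) (hm : ‖m‖ = 1) (hpm : 0 ≤ ⟪p, m⟫) {s : ℝ} (hs0 : 0 ≤ s) (hs1 : s ≤ 1) :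
    p + s • (m - p) ≠ 0 := by
  intro h
  have := norm_chord_ge hp hm hpm hs0 hs1
  rw [h, norm_zero] at this
  linarith

/-- The two-chord path of Construction 1 on the sphere: `p → m` on `[0, ½]`, `m → q` on `[½, 1]`, each a retracted chord.
[cite: Federbush1988PhaseCellIV, (11.4) p. 337] -/
def twoChord (p m q : V) (s : ℝ) : V :=
  if s ≤ 1 / 2 then radial (p + (2 * s) • (m - p)) else radial (m + (2 * s - 1) • (q - m))

/-- The two-chord path is `6|p − q|`-Lipschitz on `[0, 1]` when `m` is a unit «midpoint direction»: `⟪p, m⟫ ≥ 0`, `⟪m, q⟫ ≥ 0`,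
`|m − p|, |q − m| ≤ |p − q|`. [cite: Federbush1988PhaseCellIV, (11.4) p. 337] -/
theorem lipschitzOnWith_twoChord {p m q : V} (hp : ‖p‖ = 1) (hm : ‖m‖ = 1) (hq : ‖q‖ = 1) (hpm : 0 ≤ ⟪p, m⟫)
    (hmq : 0 ≤ ⟪m, q⟫) (h₁ : ‖m - p‖ ≤ ‖p - q‖) (h₂ : ‖q - m‖ ≤ ‖p - q‖) :
    LipschitzOnWith (6 * ‖p - q‖₊) (twoChord p m q) (Icc (0 : ℝ) 1) := by
  have hA := lipschitzOnWith_chord hp hm hpm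
  have hB := lipschitzOnWith_chord hm hq hmq
  refine lipschitzOnWith_Icc_of_glue (b := 1 / 2) ?_ ?_
  · refine LipschitzOnWith.of_dist_le_mul fun s hs s' hs' => ?_
    have hs2 : 2 * s ∈ Icc (0 : ℝ) 1 := ⟨by linarith [hs.1], by linarith [hs.2]⟩
    have hs2' : 2 * s' ∈ Icc (0 : ℝ) 1 := ⟨by linarith [hs'.1], by linarith [hs'.2]⟩
    simp only [twoChord, if_pos hs.2, if_pos hs'.2]
    calc dist (radial (p + (2 * s) • (m - p))) (radial (p + (2 * s') • (m - p)))
        ≤ ((20 / 7 : ℝ≥0) * ‖m - p‖₊ : ℝ≥0) * dist (2 * s) (2 * s') := hA.dist_le_mul _ hs2 _ hs2'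
      _ = (40 / 7 * ‖m - p‖) * dist s s' := by
          rw [Real.dist_eq, Real.dist_eq, show 2 * s - 2 * s' = 2 * (s - s') by ring, abs_mul, abs_two]
          push_cast
          ring
      _ ≤ (6 * ‖p - q‖) * dist s s' := by
          apply mul_le_mul_of_nonneg_right _ dist_nonneg
          linarith [norm_nonneg (m - p)]
      _ = (6 * ‖p - q‖₊ : ℝ≥0) * dist s s' := by push_cast; ring
  · refine LipschitzOnWith.of_dist_le_mul fun s hs s' hs' => ?_
    have hs2 : 2 * s - 1 ∈ Icc (0 : ℝ) 1 := ⟨by linarith [hs.1], by linarith [hs.2]⟩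
    have hs2' : 2 * s' - 1 ∈ Icc (0 : ℝ) 1 := ⟨by linarith [hs'.1], by linarith [hs'.2]⟩
    have key : ∀ u ∈ Icc (1 / 2 : ℝ) 1, twoChord p m q u = radial (m + (2 * u - 1) • (q - m)) := by
      intro u hu
      unfold twoChord
      split_ifs with h
      · have hu' : u = 1 / 2 := le_antisymm h hu.1
        rw [hu']
        norm_num [radial_of_norm_eq_one hm]
      · rfl
    rw [key s hs, key s' hs']
    calc dist (radial (m + (2 * s - 1) • (q - m))) (radial (m + (2 * s' - 1) • (q - m)))
        ≤ ((20 / 7 : ℝ≥0) * ‖q - m‖₊ : ℝ≥0) * dist (2 * s - 1) (2 * s' - 1) := hB.dist_le_mul _ hs2 _ hs2'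
      _ = (40 / 7 * ‖q - m‖) * dist s s' := by
          rw [Real.dist_eq, Real.dist_eq, show 2 * s - 1 - (2 * s' - 1) = 2 * (s - s') by ring, abs_mul, abs_two]
          push_cast
          ring
      _ ≤ (6 * ‖p - q‖) * dist s s' := by
          apply mul_le_mul_of_nonneg_right _ dist_nonneg
          linarith [norm_nonneg (q - m)]
      _ = (6 * ‖p - q‖₊ : ℝ≥0) * dist s s' := by push_cast; ring

/-- The two-chord path takes values on the unit sphere. [cite: Federbush1988PhaseCellIV, (11.4) p. 337] -/
theorem norm_twoChord {p m q : V} (hp : ‖p‖ = 1) (hm : ‖m‖ = 1) (hq : ‖q‖ = 1) (hpm : 0 ≤ ⟪p, m⟫) (hmq : 0 ≤ ⟪m, q⟫)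
    {s : ℝ} (hs0 : 0 ≤ s) (hs1 : s ≤ 1) : ‖twoChord p m q s‖ = 1 := by
  unfold twoChord
  split_ifs with h
  · exact norm_radial (chord_ne_zero hp hm hpm (by linarith) (by linarith))
  · exact norm_radial (chord_ne_zero hm hq hmq (by linarith [lt_of_not_ge h]) (by linarith))

/-- End points of the two-chord path: `p` at `s = 0`. [cite: Federbush1988PhaseCellIV, (11.4) p. 337] -/
theorem twoChord_zero {p m q : V} (hp : ‖p‖ = 1) : twoChord p m q 0 = p := by
  unfold twoChord
  rw [if_pos (by norm_num)]
  simp [radial_of_norm_eq_one hp]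

/-- End points of the two-chord path: `q` at `s = 1`. [cite: Federbush1988PhaseCellIV, (11.4) p. 337] -/
theorem twoChord_one {p m q : V} (hq : ‖q‖ = 1) : twoChord p m q 1 = q := by
  unfold twoChord
  rw [if_neg (by norm_num)]
  norm_num [radial_of_norm_eq_one hq]

/-- For unit `p`, `q` with `p + q ≠ 0` the normalised midpoint `m = (p+q)/|p+q|` is a midpoint direction: `⟪p, m⟫ ≥ 0` and
`|m − p| ≤ |p − q|` (`|p − m| ≤ |p − (p+q)/2| + |(p+q)/2 − m| = ½|p − q| + (1 − |(p+q)/2|) ≤ |p − q|`).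
[cite: Federbush1988PhaseCellIV, (11.4) p. 337] -/
theorem midDir_of_add_ne_zero {p q : V} (hp : ‖p‖ = 1) (hq : ‖q‖ = 1) (hpq : p + q ≠ 0) :
    0 ≤ ⟪p, radial (p + q)⟫ ∧ ‖radial (p + q) - p‖ ≤ ‖p - q‖ := by
  constructor
  · rw [radial, real_inner_smul_right, inner_add_right, real_inner_self_eq_norm_sq, hp]
    refine mul_nonneg (inv_nonneg.mpr (norm_nonneg _)) ?_
    linarith [neg_one_le_real_inner_of_norm_eq_one hp hq]
  · -- `radial (p + q) = radial w`, `w = (p + q)/2`, `|w| ≤ 1`, `|w − radial w| = 1 − |w| ≤ |p − w| = ½|p − q|`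
    set w : V := (1 / 2 : ℝ) • (p + q) with hw
    have hw0 : w ≠ 0 := by
      rw [hw]
      exact smul_ne_zero (by norm_num) hpq
    have hrad : radial (p + q) = radial w := by
      rw [hw, radial, radial, norm_smul, Real.norm_of_nonneg (by norm_num : (0 : ℝ) ≤ 1 / 2), mul_inv, smul_smul]
      congr 1
      have : ‖p + q‖ ≠ 0 := norm_ne_zero_iff.mpr hpq
      field_simp
    have hw1 : ‖w‖ ≤ 1 := by
      rw [hw, norm_smul, Real.norm_of_nonneg (by norm_num : (0 : ℝ) ≤ 1 / 2)]
      linarith [norm_add_le p q]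
    have hpw : ‖p - w‖ = 1 / 2 * ‖p - q‖ := by
      rw [hw, show p - (1 / 2 : ℝ) • (p + q) = (1 / 2 : ℝ) • (p - q) by rw [smul_add, smul_sub]; module,
        norm_smul, Real.norm_of_nonneg (by norm_num : (0 : ℝ) ≤ 1 / 2)]
    have hwge : 1 - ‖w‖ ≤ ‖p - w‖ := by
      have := norm_sub_norm_le p (p - w)
      rw [sub_sub_cancel, hp] at this
      linarith
    rw [hrad]
    calc ‖radial w - p‖ ≤ ‖radial w - w‖ + ‖w - p‖ := norm_sub_le_norm_sub_add_norm_sub _ _ _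
      _ = (1 - ‖w‖) + ‖p - w‖ := by rw [norm_sub_rev (radial w), norm_sub_radial hw0 hw1, norm_sub_rev w]
      _ ≤ ‖p - w‖ + ‖p - w‖ := by linarith
      _ = ‖p - q‖ := by rw [hpw]; ring

/-- In dimension `t ≥ 2` every unit vector has a unit vector orthogonal to it (the midpoint direction for antipodal end
values). [cite: Federbush1988PhaseCellIV, (11.4) p. 337] -/
theorem exists_unit_orthogonal {t : ℕ} (ht : 2 ≤ t) {p : EuclideanSpace ℝ (Fin t)} (hp : ‖p‖ = 1) :
    ∃ w : EuclideanSpace ℝ (Fin t), ‖w‖ = 1 ∧ ⟪p, w⟫ = 0 := by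
  have hp0 : p ≠ 0 := by
    intro h
    rw [h, norm_zero] at hp
    exact zero_ne_one hp
  have hK : Module.finrank ℝ (ℝ ∙ p)ᗮ = t - 1 := by
    have h1 := Submodule.finrank_add_finrank_orthogonal (ℝ ∙ p)
    rw [finrank_span_singleton hp0, finrank_euclideanSpace_fin] at h1
    omega
  have hne : (ℝ ∙ p)ᗮ ≠ ⊥ := by
    intro h
    rw [h, finrank_bot] at hK
    omega
  obtain ⟨w₀, hw₀, hw₀0⟩ := Submodule.exists_mem_ne_zero_of_ne_bot hne
  refine ⟨radial w₀, norm_radial hw₀0, ?_⟩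
  rw [radial, real_inner_smul_right, Submodule.mem_orthogonal_singleton_iff_inner_right.mp hw₀, mul_zero]

/-- A midpoint direction exists for every pair of unit vectors in dimension `t ≥ 2`: a unit `m` with `⟪p, m⟫ ≥ 0`, `⟪m, q⟫ ≥ 0`,
`|m − p| ≤ |p − q|`, `|q − m| ≤ |p − q|`. [cite: Federbush1988PhaseCellIV, (11.4) p. 337] -/
theorem exists_midDir {t : ℕ} (ht : 2 ≤ t) {p q : EuclideanSpace ℝ (Fin t)} (hp : ‖p‖ = 1) (hq : ‖q‖ = 1) :
    ∃ m : EuclideanSpace ℝ (Fin t), ‖m‖ = 1 ∧ 0 ≤ ⟪p, m⟫ ∧ 0 ≤ ⟪m, q⟫ ∧ ‖m - p‖ ≤ ‖p - q‖ ∧ ‖q - m‖ ≤ ‖p - q‖ := by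
  by_cases hpq : p + q = 0
  · -- antipodal: `q = −p`, take a unit vector orthogonal to `p`
    have hq' : q = -p := eq_neg_of_add_eq_zero_right hpq
    obtain ⟨w, hw, hpw⟩ := exists_unit_orthogonal ht hp
    have hpq2 : ‖p - q‖ = 2 := by
      rw [hq', sub_neg_eq_add, ← two_smul ℝ, norm_smul, Real.norm_two, hp, mul_one]
    refine ⟨w, hw, hpw.ge, ?_, ?_, ?_⟩
    · rw [hq', inner_neg_right, real_inner_comm, hpw, neg_zero]
    · rw [hpq2]
      calc ‖w - p‖ ≤ ‖w‖ + ‖p‖ := norm_sub_le _ _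
        _ = 2 := by rw [hw, hp]; norm_num
    · rw [hpq2]
      calc ‖q - w‖ ≤ ‖q‖ + ‖w‖ := norm_sub_le _ _
        _ = 2 := by rw [hw, hq]; norm_num
  · obtain ⟨h1, h2⟩ := midDir_of_add_ne_zero hp hq hpq
    obtain ⟨h3, h4⟩ := midDir_of_add_ne_zero hq hp (by rwa [add_comm])
    refine ⟨radial (p + q), norm_radial hpq, h1, ?_, h2, ?_⟩
    · rw [real_inner_comm, add_comm]
      exact h3
    · rw [add_comm, norm_sub_rev] at h4
      rw [norm_sub_rev p q]
      exact h4

end Sphere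

/-- `d/ℓ·½` bookkeeping between the ball of radius `ℓ/2` and the edge length `L_r = ℓ`: `d / (ℓ/2) = 2 · (d/ℓ)` in `ℝ≥0∞`.
[cite: Federbush1988PhaseCellIV, (11.6) p. 337] -/
theorem div_ofReal_half (d : ℝ≥0∞) (ℓ : ℝ) :
    d / ENNReal.ofReal (ℓ / 2) = 2 * (d / ENNReal.ofReal ℓ) := by
  have h2 : ENNReal.ofReal (ℓ / 2) = ENNReal.ofReal ℓ / 2 := by
    rw [ENNReal.ofReal_div_of_pos two_pos, ENNReal.ofReal_ofNat]
  rw [h2, div_eq_mul_inv, ENNReal.inv_div (Or.inl (by norm_num)) (Or.inl (by norm_num)), div_eq_mul_inv,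
    div_eq_mul_inv]
  ring

end GeomConstr

/-! ## 3. Geometric Construction 1 (11.4) for the model targets `S^{t−1}`, `t ≥ 2` -/

open GeomConstr ThmA2 in
/-- **Geometric Construction 1, (11.4), PROVED for the sphere `S^{t−1} ⊂ ℝᵗ`, `t ≥ 2`, with `c = 6`** (so for `U(1) = S¹` and
`SU(2) ≅ S³`): any two end values `g_a, g_b ∈ S^{t−1}` are joined over an edge of any length `ℓ` by a path with
`Λ₁ ≤ 6 · |g_a − g_b|/ℓ` — two retracted chords through a midpoint direction (print: «joined by a geodesic»; the chordal
reading costs the constant). [cite: Federbush1988PhaseCellIV, (11.4) p. 337] -/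
theorem geomConstruction1_sphere {t : ℕ} (ht : 2 ≤ t) : GeomConstruction1 t (sphere (0 : EuclideanSpace ℝ (Fin t)) 1) := by
  refine ⟨6, fun ℓ hℓ ga gb => ?_⟩
  have hp : ‖(ga : EuclideanSpace ℝ (Fin t))‖ = 1 := by simp
  have hq : ‖(gb : EuclideanSpace ℝ (Fin t))‖ = 1 := by simp
  obtain ⟨m, hm, hpm, hmq, h₁, h₂⟩ := exists_midDir ht hp hq
  set ψ : ℝ → EuclideanSpace ℝ (Fin t) := twoChord (ga : EuclideanSpace ℝ (Fin t)) m gb with hψ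
  have hmem : ∀ s : ↥(Icc (0 : ℝ) ℓ), ψ (s.1 / ℓ) ∈ sphere (0 : EuclideanSpace ℝ (Fin t)) 1 := fun s => by
    rw [mem_sphere_zero_iff_norm, hψ]
    exact norm_twoChord hp hm hq hpm hmq (div_nonneg s.2.1 hℓ.le) ((div_le_one hℓ).mpr s.2.2)
  refine ⟨fun s => ⟨ψ (s.1 / ℓ), hmem s⟩, ?_, ?_, ?_⟩
  · apply Subtype.ext
    show ψ (0 / ℓ) = ga
    rw [zero_div, hψ, twoChord_zero hp]
  · apply Subtype.ext
    show ψ (ℓ / ℓ) = gb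
    rw [div_self hℓ.ne', hψ, twoChord_one hq]
  · -- `Λ₁ ≤ 6|p − q|/ℓ`
    have hL := lipschitzOnWith_twoChord hp hm hq hpm hmq h₁ h₂
    set ℓ' : ℝ≥0 := Real.toNNReal ℓ with hℓ'
    have hℓ'pos : ℓ' ≠ 0 := by
      rw [hℓ']
      exact (Real.toNNReal_pos.mpr hℓ).ne'
    have hℓ'coe : (ℓ' : ℝ) = ℓ := Real.coe_toNNReal _ hℓ.le
    have hφ : LipschitzWith (6 * ‖(ga : EuclideanSpace ℝ (Fin t)) - gb‖₊ * ℓ'⁻¹)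
        (fun s : ↥(Icc (0 : ℝ) ℓ) => (⟨ψ (s.1 / ℓ), hmem s⟩ : ↥(sphere (0 : EuclideanSpace ℝ (Fin t)) 1))) := by
      refine LipschitzWith.of_dist_le_mul fun s s' => ?_
      rw [Subtype.dist_eq, Subtype.dist_eq s]
      have hs : s.1 / ℓ ∈ Icc (0 : ℝ) 1 := ⟨div_nonneg s.2.1 hℓ.le, (div_le_one hℓ).mpr s.2.2⟩
      have hs' : s'.1 / ℓ ∈ Icc (0 : ℝ) 1 := ⟨div_nonneg s'.2.1 hℓ.le, (div_le_one hℓ).mpr s'.2.2⟩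
      calc dist (ψ (s.1 / ℓ)) (ψ (s'.1 / ℓ)) ≤ (6 * ‖(ga : EuclideanSpace ℝ (Fin t)) - gb‖₊ : ℝ≥0) * dist (s.1 / ℓ) (s'.1 / ℓ) :=
            hL.dist_le_mul _ hs _ hs'
        _ = (6 * ‖(ga : EuclideanSpace ℝ (Fin t)) - gb‖₊ * ℓ'⁻¹ : ℝ≥0) * dist s.1 s'.1 := by
            rw [Real.dist_eq, Real.dist_eq, ← sub_div, abs_div, abs_of_pos hℓ]
            push_cast
            rw [hℓ'coe]
            field_simp
    calc lipConst _ ≤ ((6 * ‖(ga : EuclideanSpace ℝ (Fin t)) - gb‖₊ * ℓ'⁻¹ : ℝ≥0) : ℝ≥0∞) := lipConst_le_of_lipschitzWith hφ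
      _ = 6 * edist ga gb / ENNReal.ofReal ℓ := by
          rw [Subtype.edist_eq, edist_nndist, nndist_eq_nnnorm, show ENNReal.ofReal ℓ = (ℓ' : ℝ≥0∞) from rfl,
            ENNReal.coe_mul, ENNReal.coe_mul, ENNReal.coe_inv hℓ'pos, div_eq_mul_inv]
          push_cast
          ring

/-- `U(1) = S¹ ⊂ ℝ²`: Construction 1 on the circle. [cite: Federbush1988PhaseCellIV, (11.4) p. 337] -/
theorem geomConstruction1_circle : GeomConstruction1 2 (sphere (0 : EuclideanSpace ℝ (Fin 2)) 1) :=
  geomConstruction1_sphere le_rfl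

/-- `SU(2) ≅ S³ ⊂ ℝ⁴`: Construction 1 on the three-sphere. [cite: Federbush1988PhaseCellIV, (11.4) p. 337] -/
theorem geomConstruction1_threeSphere : GeomConstruction1 4 (sphere (0 : EuclideanSpace ℝ (Fin 4)) 1) :=
  geomConstruction1_sphere (by norm_num)

open GeomConstr ThmA2 in
/-- Print's remark after (11.4): «if `φ′₁(v_a)` and `φ′₁(v_b)` are close enough, then they may be joined by a geodesic, and `c`
picked equal 1» — embedded companion: in a uniformly Lipschitz-retractable `M` (`P` an `L`-Lipschitz retraction of the
`r`-neighbourhood), two end values at distance `< r` are joined over an edge of length `ℓ` by the retracted chord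
`s ↦ P(g_a + (s/ℓ)(g_b − g_a))`, with `Λ₁ ≤ L · |g_a − g_b|/ℓ`. [cite: Federbush1988PhaseCellIV, (11.4) p. 337] -/
theorem exists_shortPath_of_retract {t : ℕ} {M : Set (EuclideanSpace ℝ (Fin t))} {r : ℝ} {L : ℝ≥0}
    {P : EuclideanSpace ℝ (Fin t) → EuclideanSpace ℝ (Fin t)} (hPL : LipschitzOnWith L P {y | infDist y M < r})
    (hPM : MapsTo P {y | infDist y M < r} M) (hPid : ∀ y ∈ M, P y = y) {ℓ : ℝ} (hℓ : 0 < ℓ) (ga gb : ↥M)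
    (hd : dist ga gb < r) :
    ∃ φ : ↥(Icc (0 : ℝ) ℓ) → ↥M,
      φ ⟨0, left_mem_Icc.mpr hℓ.le⟩ = ga ∧ φ ⟨ℓ, right_mem_Icc.mpr hℓ.le⟩ = gb ∧
        lipConst φ ≤ L * edist ga gb / ENNReal.ofReal ℓ := by
  set p : EuclideanSpace ℝ (Fin t) := (ga : EuclideanSpace ℝ (Fin t)) with hp
  set q : EuclideanSpace ℝ (Fin t) := (gb : EuclideanSpace ℝ (Fin t)) with hq
  have hU : ∀ s : ℝ, 0 ≤ s → s ≤ 1 → p + s • (q - p) ∈ {y | infDist y M < r} := by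
    intro s hs0 hs1
    show infDist (p + s • (q - p)) M < r
    calc infDist (p + s • (q - p)) M ≤ dist (p + s • (q - p)) p := infDist_le_dist_of_mem ga.2
      _ = s * dist gb ga := by
          rw [dist_eq_norm, add_sub_cancel_left, norm_smul, Real.norm_of_nonneg hs0, Subtype.dist_eq, dist_eq_norm]
      _ ≤ 1 * dist ga gb := by rw [dist_comm]; gcongr
      _ < r := by rwa [one_mul]
  have hmem : ∀ s : ↥(Icc (0 : ℝ) ℓ), P (p + (s.1 / ℓ) • (q - p)) ∈ M := fun s =>
    hPM (hU _ (div_nonneg s.2.1 hℓ.le) ((div_le_one hℓ).mpr s.2.2))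
  refine ⟨fun s => ⟨P (p + (s.1 / ℓ) • (q - p)), hmem s⟩, ?_, ?_, ?_⟩
  · apply Subtype.ext
    show P (p + (0 / ℓ) • (q - p)) = ga
    rw [zero_div, zero_smul, add_zero, hPid _ ga.2]
  · apply Subtype.ext
    show P (p + (ℓ / ℓ) • (q - p)) = gb
    rw [div_self hℓ.ne', one_smul, add_sub_cancel, hPid _ gb.2]
  · set ℓ' : ℝ≥0 := Real.toNNReal ℓ with hℓ'
    have hℓ'pos : ℓ' ≠ 0 := by
      rw [hℓ']
      exact (Real.toNNReal_pos.mpr hℓ).ne'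
    have hℓ'coe : (ℓ' : ℝ) = ℓ := Real.coe_toNNReal _ hℓ.le
    have hφ : LipschitzWith (L * ‖p - q‖₊ * ℓ'⁻¹)
        (fun s : ↥(Icc (0 : ℝ) ℓ) => (⟨P (p + (s.1 / ℓ) • (q - p)), hmem s⟩ : ↥M)) := by
      refine LipschitzWith.of_dist_le_mul fun s s' => ?_
      rw [Subtype.dist_eq, Subtype.dist_eq s]
      calc dist (P (p + (s.1 / ℓ) • (q - p))) (P (p + (s'.1 / ℓ) • (q - p)))
          ≤ L * dist (p + (s.1 / ℓ) • (q - p)) (p + (s'.1 / ℓ) • (q - p)) :=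
            hPL.dist_le_mul _ (hU _ (div_nonneg s.2.1 hℓ.le) ((div_le_one hℓ).mpr s.2.2)) _
              (hU _ (div_nonneg s'.2.1 hℓ.le) ((div_le_one hℓ).mpr s'.2.2))
        _ = (L * ‖p - q‖₊ * ℓ'⁻¹ : ℝ≥0) * dist s.1 s'.1 := by
            rw [dist_eq_norm, show p + (s.1 / ℓ) • (q - p) - (p + (s'.1 / ℓ) • (q - p)) = (s.1 / ℓ - s'.1 / ℓ) • (q - p) by
              rw [sub_smul]; abel, norm_smul, ← sub_div, Real.norm_eq_abs, abs_div, abs_of_pos hℓ, Real.dist_eq,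
              norm_sub_rev q p]
            push_cast
            rw [hℓ'coe]
            field_simp
    calc lipConst _ ≤ ((L * ‖p - q‖₊ * ℓ'⁻¹ : ℝ≥0) : ℝ≥0∞) := lipConst_le_of_lipschitzWith hφ
      _ = L * edist ga gb / ENNReal.ofReal ℓ := by
          rw [Subtype.edist_eq, edist_nndist, nndist_eq_nnnorm, show ENNReal.ofReal ℓ = (ℓ' : ℝ≥0∞) from rfl,
            ENNReal.coe_mul, ENNReal.coe_mul, ENNReal.coe_inv hℓ'pos, div_eq_mul_inv]

/-! ## 4. Theorem A.2 at scale `R` and Geometric Construction 2 (11.5)–(11.6) -/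

open GeomConstr in
/-- **Theorem A.2 (embedded reading) on balls of radius `R`** (same `ε_M`, `c₁`, `c₂`): for `f₁, f₂ : ∂B_R → M`,
`f₁^e : B_R → M` extending `f₁`, `d^M(f₁, f₂) ≤ ε_M` ⇒ an extension `f₂^e` of `f₂` with `d^M(f₁^e, f₂^e) ≤ c₁ d^M(f₁, f₂)` and
`Λ₁(f₂^e) ≤ c₂[Λ₁(f₁^e) + d^M(f₁, f₂)/R + Λ₁(f₂)]` — by conjugating with the dilation `x ↦ Rx` (`Λ₁` scales by `R`, `d^M` does
not: this is the `1/L_r` of (11.6)). [cite: Federbush1988PhaseCellIV, Theorem A.2 p. 341; (11.6) p. 337] -/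
theorem thmA2Emb_rescale {n t : ℕ} {M : Set (EuclideanSpace ℝ (Fin t))} (h : ThmA2Emb n t M) :
    ∃ εM : ℝ≥0, 0 < εM ∧ ∃ c₁ c₂ : ℝ≥0, ∀ R : ℝ, 0 < R →
      ∀ (f₁ f₂ : ↥(sphere (0 : EuclideanSpace ℝ (Fin n)) R) → ↥M)
        (f₁e : ↥(closedBall (0 : EuclideanSpace ℝ (Fin n)) R) → ↥M),
        (∀ x : ↥(sphere (0 : EuclideanSpace ℝ (Fin n)) R), f₁e ⟨x.1, sphere_subset_closedBall x.2⟩ = f₁ x) →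
        supDist f₁ f₂ ≤ εM →
        ∃ f₂e : ↥(closedBall (0 : EuclideanSpace ℝ (Fin n)) R) → ↥M,
          (∀ x : ↥(sphere (0 : EuclideanSpace ℝ (Fin n)) R), f₂e ⟨x.1, sphere_subset_closedBall x.2⟩ = f₂ x) ∧
          supDist f₁e f₂e ≤ c₁ * supDist f₁ f₂ ∧
          lipConst f₂e ≤ c₂ * (lipConst f₁e + supDist f₁ f₂ / ENNReal.ofReal R + lipConst f₂) := by
  obtain ⟨εM, hε, c₁, c₂, H⟩ := h
  refine ⟨εM, hε, c₁, c₂, fun R hR f₁ f₂ f₁e hext hδ => ?_⟩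
  -- the dilations between the unit ball/sphere and the ball/sphere of radius `R`
  have hdil : ∀ x : EuclideanSpace ℝ (Fin n), x ∈ closedBall (0 : EuclideanSpace ℝ (Fin n)) 1 →
      R • x ∈ closedBall (0 : EuclideanSpace ℝ (Fin n)) R := fun x hx => by
    rw [mem_closedBall_zero_iff] at hx ⊢
    rw [norm_smul, Real.norm_of_nonneg hR.le]
    nlinarith
  have hdilS : ∀ x : EuclideanSpace ℝ (Fin n), x ∈ sphere (0 : EuclideanSpace ℝ (Fin n)) 1 →
      R • x ∈ sphere (0 : EuclideanSpace ℝ (Fin n)) R := fun x hx => by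
    rw [mem_sphere_zero_iff_norm] at hx ⊢
    rw [norm_smul, Real.norm_of_nonneg hR.le, hx, mul_one]
  have hshr : ∀ x : EuclideanSpace ℝ (Fin n), x ∈ closedBall (0 : EuclideanSpace ℝ (Fin n)) R →
      R⁻¹ • x ∈ closedBall (0 : EuclideanSpace ℝ (Fin n)) 1 := fun x hx => by
    rw [mem_closedBall_zero_iff] at hx ⊢
    rw [norm_smul, norm_inv, Real.norm_of_nonneg hR.le, inv_mul_le_iff₀ hR]
    linarith
  have hshrS : ∀ x : EuclideanSpace ℝ (Fin n), x ∈ sphere (0 : EuclideanSpace ℝ (Fin n)) R →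
      R⁻¹ • x ∈ sphere (0 : EuclideanSpace ℝ (Fin n)) 1 := fun x hx => by
    rw [mem_sphere_zero_iff_norm] at hx ⊢
    rw [norm_smul, norm_inv, Real.norm_of_nonneg hR.le, hx, inv_mul_cancel₀ hR.ne']
  set dil : ↥(closedBall (0 : EuclideanSpace ℝ (Fin n)) 1) → ↥(closedBall (0 : EuclideanSpace ℝ (Fin n)) R) :=
    fun x => ⟨R • x.1, hdil x.1 x.2⟩ with hdil_def
  set dilS : ↥(sphere (0 : EuclideanSpace ℝ (Fin n)) 1) → ↥(sphere (0 : EuclideanSpace ℝ (Fin n)) R) :=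
    fun x => ⟨R • x.1, hdilS x.1 x.2⟩ with hdilS_def
  set shr : ↥(closedBall (0 : EuclideanSpace ℝ (Fin n)) R) → ↥(closedBall (0 : EuclideanSpace ℝ (Fin n)) 1) :=
    fun x => ⟨R⁻¹ • x.1, hshr x.1 x.2⟩ with hshr_def
  set R' : ℝ≥0 := Real.toNNReal R with hR'
  have hR'coe : (R' : ℝ) = R := Real.coe_toNNReal _ hR.le
  have hR'0 : R' ≠ 0 := by
    rw [hR']
    exact (Real.toNNReal_pos.mpr hR).ne'
  have hdilL : LipschitzWith R' dil := LipschitzWith.of_dist_le_mul fun x y => by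
    rw [Subtype.dist_eq, Subtype.dist_eq x, hdil_def]
    simp only
    rw [dist_smul₀, Real.norm_of_nonneg hR.le, hR'coe]
  have hdilSL : LipschitzWith R' dilS := LipschitzWith.of_dist_le_mul fun x y => by
    rw [Subtype.dist_eq, Subtype.dist_eq x, hdilS_def]
    simp only
    rw [dist_smul₀, Real.norm_of_nonneg hR.le, hR'coe]
  have hshrL : LipschitzWith R'⁻¹ shr := LipschitzWith.of_dist_le_mul fun x y => by
    rw [Subtype.dist_eq, Subtype.dist_eq x, hshr_def]
    simp only
    rw [dist_smul₀, norm_inv, Real.norm_of_nonneg hR.le, NNReal.coe_inv, hR'coe]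
  -- the unit-scale data
  have hgext : ∀ x : ↥(sphere (0 : EuclideanSpace ℝ (Fin n)) 1),
      (f₁e ∘ dil) ⟨x.1, sphere_subset_closedBall x.2⟩ = (f₁ ∘ dilS) x := fun x =>
    hext ⟨R • x.1, hdilS x.1 x.2⟩
  have hgδ : supDist (f₁ ∘ dilS) (f₂ ∘ dilS) ≤ supDist f₁ f₂ := supDist_comp_le f₁ f₂ dilS
  obtain ⟨g₂e, hg₂ext, hg18, hg19⟩ := H (f₁ ∘ dilS) (f₂ ∘ dilS) (f₁e ∘ dil) hgext (hgδ.trans hδ)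
  have hround : ∀ x : ↥(closedBall (0 : EuclideanSpace ℝ (Fin n)) R), dil (shr x) = x := fun x => by
    apply Subtype.ext
    show R • (R⁻¹ • x.1) = x.1
    rw [smul_smul, mul_inv_cancel₀ hR.ne', one_smul]
  refine ⟨g₂e ∘ shr, fun x => ?_, ?_, ?_⟩
  · -- extension of `f₂`
    have h1 := hg₂ext ⟨R⁻¹ • x.1, hshrS x.1 x.2⟩
    have h2 : (f₂ ∘ dilS) ⟨R⁻¹ • x.1, hshrS x.1 x.2⟩ = f₂ x := by
      show f₂ (dilS ⟨R⁻¹ • x.1, hshrS x.1 x.2⟩) = f₂ x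
      congr 1
      apply Subtype.ext
      show R • (R⁻¹ • x.1) = x.1
      rw [smul_smul, mul_inv_cancel₀ hR.ne', one_smul]
    exact h1.trans h2
  · -- (A.18)
    refine (iSup_le fun x => ?_).trans (hg18.trans ?_)
    · have : f₁e x = (f₁e ∘ dil) (shr x) := by
        show f₁e x = f₁e (dil (shr x))
        rw [hround x]
      rw [this]
      exact edist_le_supDist (f₁e ∘ dil) g₂e (shr x)
    · gcongr
  · -- (A.19)
    have hr : ENNReal.ofReal R = (R' : ℝ≥0∞) := rfl
    have hRR : ((R'⁻¹ : ℝ≥0) : ℝ≥0∞) * R' = 1 := by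
      rw [← ENNReal.coe_mul, inv_mul_cancel₀ hR'0, ENNReal.coe_one]
    calc lipConst (g₂e ∘ shr) ≤ (R'⁻¹ : ℝ≥0) * lipConst g₂e := lipConst_comp_le g₂e hshrL
      _ ≤ (R'⁻¹ : ℝ≥0) * (c₂ * (lipConst (f₁e ∘ dil) + supDist (f₁ ∘ dilS) (f₂ ∘ dilS) + lipConst (f₂ ∘ dilS))) := by
          gcongr
      _ ≤ (R'⁻¹ : ℝ≥0) * (c₂ * (R' * lipConst f₁e + supDist f₁ f₂ + R' * lipConst f₂)) := by
          gcongr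
          · exact lipConst_comp_le f₁e hdilL
          · exact lipConst_comp_le f₂ hdilSL
      _ = c₂ * ((((R'⁻¹ : ℝ≥0) : ℝ≥0∞) * R') * lipConst f₁e + supDist f₁ f₂ * (R'⁻¹ : ℝ≥0) +
            (((R'⁻¹ : ℝ≥0) : ℝ≥0∞) * R') * lipConst f₂) := by ring
      _ = c₂ * (lipConst f₁e + supDist f₁ f₂ / ENNReal.ofReal R + lipConst f₂) := by
          rw [hRR, one_mul, one_mul, hr, div_eq_mul_inv, ENNReal.coe_inv hR'0]

open GeomConstr in
/-- **Geometric Construction 2, (11.5)–(11.6), DERIVED from Theorem A.2 (embedded reading) in dimension `n = 1`** for every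
target `M ⊆ Rᵗ` satisfying `ThmA2Emb 1 t M`: `ε = ε_M`, `c = c₁ + 2c₂` (the edge of length `ℓ` is the ball of radius `ℓ/2`,
whence the factor `2` in front of `d^g/L_r`). [cite: Federbush1988PhaseCellIV, (11.5)–(11.6) p. 337; Theorem A.2 p. 341] -/
theorem geomConstruction2_of_thmA2Emb {t : ℕ} {M : Set (EuclideanSpace ℝ (Fin t))} (h : ThmA2Emb 1 t M) :
    GeomConstruction2 t M := by
  obtain ⟨εM, hε, c₁, c₂, H⟩ := thmA2Emb_rescale h
  refine ⟨εM, hε, c₁ + 2 * c₂, fun ℓ hℓ φ₁ φ₂ eφ₁ hext hδ => ?_⟩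
  obtain ⟨eφ₂, hext₂, h5, h6⟩ := H (ℓ / 2) (half_pos hℓ) φ₁ φ₂ eφ₁ hext hδ
  refine ⟨eφ₂, hext₂, h5.trans ?_, h6.trans ?_⟩
  · gcongr
    exact_mod_cast (le_self_add : c₁ ≤ c₁ + 2 * c₂)
  · rw [div_ofReal_half _ ℓ]
    have two : ∀ x : ℝ≥0∞, x ≤ 2 * x := fun x => le_mul_of_one_le_left zero_le one_le_two
    calc (c₂ : ℝ≥0∞) * (lipConst eφ₁ + 2 * (supDist φ₁ φ₂ / ENNReal.ofReal ℓ) + lipConst φ₂)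
        ≤ (c₂ : ℝ≥0∞) * (2 * lipConst eφ₁ + 2 * (supDist φ₁ φ₂ / ENNReal.ofReal ℓ) + 2 * lipConst φ₂) := by
          gcongr
          · exact two _
          · exact two _
      _ = ((2 * c₂ : ℝ≥0) : ℝ≥0∞) * (lipConst eφ₁ + supDist φ₁ φ₂ / ENNReal.ofReal ℓ + lipConst φ₂) := by
          push_cast
          ring
      _ ≤ ((c₁ + 2 * c₂ : ℝ≥0) : ℝ≥0∞) * (lipConst eφ₁ + supDist φ₁ φ₂ / ENNReal.ofReal ℓ + lipConst φ₂) := by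
          gcongr
          exact_mod_cast (le_add_self : 2 * c₂ ≤ c₁ + 2 * c₂)

/-- **Geometric Construction 2 for every uniformly Lipschitz-retractable `M ⊆ Rᵗ`** (from `thmA2Emb_of_retract` with `n = 1`).
[cite: Federbush1988PhaseCellIV, (11.5)–(11.6) p. 337] -/
theorem geomConstruction2_of_retract {t : ℕ} {M : Set (EuclideanSpace ℝ (Fin t))} {r : ℝ} (hr : 0 < r) {L : ℝ≥0}
    {P : EuclideanSpace ℝ (Fin t) → EuclideanSpace ℝ (Fin t)} (hPL : LipschitzOnWith L P {y | infDist y M < r})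
    (hPM : MapsTo P {y | infDist y M < r} M) (hPid : ∀ y ∈ M, P y = y) : GeomConstruction2 t M :=
  geomConstruction2_of_thmA2Emb (thmA2Emb_of_retract hr hPL hPM hPid 1)

/-- **Geometric Construction 2 for the model targets `S^{t−1}`**, every `t`, hypothesis-free (so for `U(1) = S¹`, `SU(2) ≅ S³`).
[cite: Federbush1988PhaseCellIV, (11.5)–(11.6) p. 337] -/
theorem geomConstruction2_sphere (t : ℕ) : GeomConstruction2 t (sphere (0 : EuclideanSpace ℝ (Fin t)) 1) :=
  geomConstruction2_of_thmA2Emb (thmA2Emb_sphere 1 t)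

/-- Constructions 1 AND 2 together on the circle `U(1) = S¹`. [cite: Federbush1988PhaseCellIV, (11.4)–(11.6) p. 337] -/
theorem geomConstructions_circle :
    GeomConstruction1 2 (sphere (0 : EuclideanSpace ℝ (Fin 2)) 1) ∧ GeomConstruction2 2 (sphere (0 : EuclideanSpace ℝ (Fin 2)) 1) :=
  ⟨geomConstruction1_circle, geomConstruction2_sphere 2⟩

/-- Constructions 1 AND 2 together on the three-sphere `SU(2) ≅ S³`. [cite: Federbush1988PhaseCellIV, (11.4)–(11.6) p. 337] -/
theorem geomConstructions_threeSphere :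
    GeomConstruction1 4 (sphere (0 : EuclideanSpace ℝ (Fin 4)) 1) ∧ GeomConstruction2 4 (sphere (0 : EuclideanSpace ℝ (Fin 4)) 1) :=
  ⟨geomConstruction1_threeSphere, geomConstruction2_sphere 4⟩

end PhaseCellIVAppA

end

end Literature.MathematicalPhysics.QuantumFieldTheory.Federbush1986
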